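/-
Copyright: the b2b-balaban T⁴-continuum CRUX team, row NE7b leaf lineage `t4-ne7b-formalise-leaf-06` (gen 162). Project licence.
-/
import Summits.QuantumFields.BalabanUV.T4Continuum.Spine.NE7b.SupEquationTowerLetters
import Summits.QuantumFields.BalabanUV.T4Continuum.Spine.NE7b.SupResponseSecondCurrency

/-!
# THE COMPOSITE RESPONSE OFF THE ORIGIN WITH ONE BOOTSTRAP CONSTANT: by `…SupEquationTowerOneShot.tower_eq_oneShot` the tower's
# composite transport IS the one-shot branch, `Φ_k = σ₀ₖ` on `closedBall 0 r_k`, so on the open ball `ball 0 r_k` their DERIVATIVES agree,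
# `DΦ_k(w) = Dσ₀ₖ(w)`; and `…SupResponseSecondCurrency`'s bootstrap at the COMPOSITE level (one-shot chart `T₀ₖ` with seminorm letter
# `N^w_{0k}`, level-`0` second-currency modulus `M^w_0`, defect `c^w_{0k} ≥ C^w_{P₀ₖ} M^w_0 r_0`, `N^w_{0k} c^w_{0k} < 1`) gives
# `p_0(DΦ_k(w) v) ≤ K^w_{0k}·p_k(v)` with ONE constant `K^w_{0k} = N^w_{0k}∕(1 − N^w_{0k} c^w_{0k})` on `ball 0 r_k ∩ ball 0 ρ₀ₖ`, together
# with the composite covariance column's letter and the composite response's two-point modulus — the abstract CLOSED FORM replacing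
# `…SupEquationTowerWeighted`'s displayed product `∏_{j<k} K^w_j`
# (row NE7b, node U5c; STL ∕ SIS ∕ SRSC BY NAME, SOS's identification argument inlined; [folklore]; any Banach currencies, any seminorms)

Cell `pub-balaban`, sub-cell `t4`, spine estimate NE7b (`T4WeightBudget.RelWeightBound`; the cell's OWN estimate — NOT PRINTED in
[Bałaban 1983–89], NOT PROVED).  Crux-route work under `Spine/NE7b/` by a row leaf (`t4-ne7b-formalise-leaf-06` gen 162) under FREEZE
(0)'s crux-prover clause (the OWNER g115's ι-3 answer taken [NE7bLEAF06-G162-ONLINE]; W-ne7bp1-g116-1 (b)).  NOTHING of Bałaban's is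
named as a Lean object, valued or asserted; no `T4Continuum/Support` leaf typed; no `def`; zero `sorry`.  Imports: this lineage's
`…SupEquationTowerLetters` (STL; through it TOWER ∕ STEP ∕ SIS — SOS's two §1 arguments are inlined, so that this file does not wait on
SOS's hub olean) and `…SupResponseSecondCurrency` (SRSC).

WHY (located).  The pricing desk's standing objection to the tower's letters is the PRODUCT (`∏ K₁ⱼ`, `∏ N^w_j`, TOWERW's `∏ K^w_j`):
each factor exceeds `1`, nothing controls it.  SECS already names the cure AT THE ORIGIN — a consumer holding the ONE-SHOT chart of the
composite blocking reads `𝒮_k = T₀ₖ⁻¹∘inl` with that chart's single constant — and the OWNER's model supplies exactly such charts at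
every composite side with side-uniform letters ((62) `weighted_augInverse`, (72) `exists_aug_equiv_sup_periodic`: «every side, the same
`N_∞`»; his C-ne7bp1-g116-2 `SupBackgroundSemigroup` is the model's semigroup identity for the interacting background).  OFF the origin
the same cure is SOS + SRSC: `Φ_k = σ₀ₖ` on `closedBall 0 r_k` (SOS), hence `DΦ_k = Dσ₀ₖ` on the OPEN ball `ball 0 r_k`
(`Filter.EventuallyEq.fderiv_eq`), and `Dσ₀ₖ(w)` obeys SRSC's bootstrap for the one-shot chart wherever `σ₀ₖ` is differentiable, i.e. on
the one-shot open chart ball `ball 0 ρ₀ₖ`, `ρ₀ₖ = (N₀ₖ⁻¹ − c₀ₖ)r_0`.  The defect is level-`0` data only: `c^w_{0k} ≥ C^w_{P₀ₖ}·M^w_0·r_0`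
(here pointwise in `‖x‖`, then `‖x‖ ≤ r_0`; STEPW `seminorm_defect_le_of_modulus_closedBall` is the `r`-form).  So the composite
response carries ONE bootstrap constant `K^w_{0k}`, whose only `k`-dependence is through the one-shot chart's `N^w_{0k}` and the composite
fibre projection's `C^w_{P₀ₖ}` — both side-uniform in the model by the OWNER's files.  HONEST: the two balls are NOT compared (`r_k` vs
`ρ₀ₖ`: numbers, (A3)); the letter is stated on the intersection of the open balls; nothing is small by itself (`K^w_{0k} ≥ N^w_{0k}`).

WHAT IS PROVED ([folklore]; `X, K : ℕ → Type`, every `X k` a nontrivial real Banach space; `K₀` real normed; `p₀, p_k, q₀` seminorms):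
* §1 `fderiv_eq_of_eqOn_closedBall` (`Φ = σ₀` on `closedBall 0 r` ⟹ `fderiv Φ w = fderiv σ₀ w` and `DifferentiableAt` transfers, for
  `w ∈ ball 0 r`), `seminorm_defect_le_of_modulus_norm` (the level-`0` defect pointwise in the radius,
  `q₀(P₀((Y 0 − Y x)u)) ≤ C^w_{P₀}·M^w_0·‖x‖·p₀ u` on `closedBall 0 r_0`; STEPW's §1 is the `r`-form).
* §2 **`tower_eq_oneShot_weighted`** — `tower_eq_oneShot`'s hypotheses VERBATIM ⟹ `∃ σ Eq Eq′ 𝒮 Φ σ₀ₖ` with SOS's conclusions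
  RE-EXPORTED (recursion equations, composite letters, composite lift, `HasFDerivAt (Φ j) (𝒮 j) 0`, the one-shot branch's (a) letters,
  Lipschitz, uniqueness, the identification `Φ k = σ₀ₖ` on `closedBall 0 r_k`) AND: (O-b) the one-shot branch's derivative letters on
  `ball 0 ρ₀ₖ` (differentiable, `‖Dσ₀ₖ‖ ≤ (N₀ₖ⁻¹ − c₀ₖ)⁻¹`, `𝒬_k∘Dσ₀ₖ(w) = 1`, `P₀ₖ(Eq₀′(σ₀ₖ w)(Dσ₀ₖ(w) y)) = 0`); (ID′) on
  `ball 0 r_k ∩ ball 0 ρ₀ₖ`: `Φ k` differentiable and **`fderiv (Φ k) w = fderiv σ₀ₖ w`**; AND — quantified AFTER the tower and the branch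
  (one object for all admissible weights) — for every second currency at the composite level (seminorms `p₀` on `X 0`, `p_k` on `X k`,
  `q₀` on `K₀`; `0 ≤ N^w_{0k}, M^w_0, C^w_{P₀ₖ}`; the one-shot chart's letter `p₀(T₀ₖ⁻¹(y₁,y₂)) ≤ N^w_{0k}(p_k y₁ + q₀ y₂)`; the level-`0`
  modulus `p₀((Eq₀′ x − Eq₀′ x′)u) ≤ M^w_0‖x − x′‖p₀ u` on `closedBall 0 r_0`; `q₀(P₀ₖ h) ≤ C^w_{P₀ₖ} p₀ h`; `C^w_{P₀ₖ} M^w_0 r_0 ≤ c^w_{0k}`,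
  `N^w_{0k} c^w_{0k} < 1`): (OW1) the COMPOSITE COVARIANCE COLUMN on `closedBall 0 ρ₀ₖ`, `𝒬_k u = 0 → p₀ u ≤ K^w_{0k} q₀(P₀ₖ(Eq₀′(σ₀ₖ w) u))`;
  (OW2) `p₀(Dσ₀ₖ(w) y) ≤ K^w_{0k} p_k y` and (OW3) the two-point modulus
  `p₀((Dσ₀ₖ w − Dσ₀ₖ w′) y) ≤ K^w_{0k} C^w_{P₀ₖ} M^w_0 (N₀ₖ⁻¹ − c₀ₖ)⁻¹ K^w_{0k} ‖w − w′‖ p_k y` on `ball 0 ρ₀ₖ`; (OW4) on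
  `ball 0 r_k ∩ ball 0 ρ₀ₖ`: **`p₀(fderiv (Φ k) w y) ≤ K^w_{0k}·p_k y`**.
* §3 toy (`example`).

NOT HERE (honest): `T₀ₖ`, `N₀ₖ`, `N^w_{0k}` BY VALUE and their side-uniformity (the OWNER's (62) ∕ (72) ∕ C-116-2 in the model); the
comparison `r_k ≤ ρ₀ₖ`; the `ℓ^∞(ℤ^d)` instance; (A3) ∕ (A1c); NC-NE7b-α UNRULED; anything of Bałaban's.  BY-NAME EFFECT ON THE WALL:
NONE.  NE7b NOT PRINTED ∕ NOT PROVED; spine PROVED 0∕9; rung (B)+1 on a FINITE torus — NOT infinite volume, NOT the mass gap, NOT Clay.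
HONEST DEPENDENCY: continuum YM on T⁴ ⇐ BetaPertH ∧ nine spine estimates (0∕9 proved); BetaPertH ⇐ (D1) ∧ (D4) ∧ CAP+tail;
G-an2-4 gates asym, D1 and NE2∕3∕4.
-/

set_option autoImplicit false

noncomputable section

namespace Summit.QuantumFields.BalabanUV.T4Continuum.NE7b.SupEquationTowerOneShotWeighted

open Set Metric Function Filter
open scoped NNReal Topology
open Summit.QuantumFields.BalabanUV.T4Continuum.NE7b

/-! ## §1. Two letters -/

section Letters

variable {E F G : Type*} [NormedAddCommGroup E] [NormedSpace ℝ E] [NormedAddCommGroup F] [NormedSpace ℝ F]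
  [NormedAddCommGroup G] [NormedSpace ℝ G]

/-- If `Φ = σ₀` on `closedBall 0 r` then at every point of the OPEN ball `ball 0 r` the derivatives agree, `fderiv Φ w = fderiv σ₀ w`,
and differentiability transfers from `σ₀` to `Φ`. [folklore] -/
theorem fderiv_eq_of_eqOn_closedBall {Φ σ₀ : F → E} {r : ℝ} (heq : ∀ w ∈ closedBall (0 : F) r, Φ w = σ₀ w) {w : F}
    (hw : w ∈ ball (0 : F) r) :
    fderiv ℝ Φ w = fderiv ℝ σ₀ w ∧ (DifferentiableAt ℝ σ₀ w → DifferentiableAt ℝ Φ w) := by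
  have hev : Φ =ᶠ[𝓝 w] σ₀ :=
    Filter.eventuallyEq_of_mem (isOpen_ball.mem_nhds hw) fun z hz => heq z (ball_subset_closedBall hz)
  exact ⟨hev.fderiv_eq, fun hd => hd.congr_of_eventuallyEq hev⟩

/-- The second-currency defect from the modulus, POINTWISE IN THE RADIUS: `q(P h) ≤ C^w_P p h`, `p((Y x − Y x′)u) ≤ M^w‖x − x′‖p u` on
`closedBall 0 r`, `0 ≤ C^w_P` ⟹ `q(P((Y 0 − Y x)u)) ≤ C^w_P·M^w·‖x‖·p u` for `x ∈ closedBall 0 r` (the sibling STEPW states the `r`-form). [folklore] -/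
theorem seminorm_defect_le_of_modulus_norm {Y : E → E →L[ℝ] E} {r Mw CPw : ℝ} (P : E →L[ℝ] G) (p : Seminorm ℝ E) (q : Seminorm ℝ G)
    (hCPw0 : 0 ≤ CPw) (hCPw : ∀ h, q (P h) ≤ CPw * p h)
    (hY : ∀ x ∈ closedBall (0 : E) r, ∀ x' ∈ closedBall (0 : E) r, ∀ u, p ((Y x - Y x') u) ≤ Mw * ‖x - x'‖ * p u)
    {x : E} (hx : x ∈ closedBall (0 : E) r) (u : E) : q (P ((Y 0 - Y x) u)) ≤ CPw * Mw * ‖x‖ * p u := by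
  have hr : 0 ≤ r := le_trans dist_nonneg (mem_closedBall.1 hx)
  have h0 : (0 : E) ∈ closedBall (0 : E) r := mem_closedBall_self hr
  calc q (P ((Y 0 - Y x) u)) ≤ CPw * p ((Y 0 - Y x) u) := hCPw _
    _ ≤ CPw * (Mw * ‖(0 : E) - x‖ * p u) := mul_le_mul_of_nonneg_left (hY 0 h0 x hx u) hCPw0
    _ = CPw * Mw * ‖x‖ * p u := by rw [zero_sub, norm_neg]; ring

end Letters

/-! ## §2. On the tower: the composite response with ONE bootstrap constant -/

variable {X : ℕ → Type*} {K : ℕ → Type*} [∀ k, NormedAddCommGroup (X k)] [∀ k, NormedSpace ℝ (X k)]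
  [∀ k, NormedAddCommGroup (K k)] [∀ k, NormedSpace ℝ (K k)]
  {K₀ : Type*} [NormedAddCommGroup K₀] [NormedSpace ℝ K₀]

/-- **THE COMPOSITE RESPONSE OFF THE ORIGIN WITH ONE BOOTSTRAP CONSTANT.**  `…SupEquationTowerOneShot.tower_eq_oneShot`'s hypotheses
verbatim ⟹ SOS's conclusions, the one-shot branch's derivative letters, on `ball 0 r_k ∩ ball 0 ρ₀ₖ` the identification of the
DERIVATIVES `fderiv (Φ k) w = fderiv σ₀ₖ w`, and — for every second currency at the composite level chosen AFTERWARDS (seminorms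
`p₀, p_k, q₀`; the one-shot chart's letter `N^w_{0k}`; the level-`0` modulus `M^w_0`; `q₀∘P₀ₖ ≤ C^w_{P₀ₖ} p₀`; `C^w_{P₀ₖ} M^w_0 r_0 ≤ c^w_{0k}`,
`N^w_{0k} c^w_{0k} < 1`) — SRSC's (OW1) (OW2) (OW3) for the one-shot branch and the composite response letter
`p₀(DΦ_k(w) y) ≤ K^w_{0k} p_k y`, `K^w_{0k} = N^w_{0k}∕(1 − N^w_{0k} c^w_{0k})`. [folklore] -/
theorem tower_eq_oneShot_weighted [∀ j, CompleteSpace (X j)] [∀ j, Nontrivial (X j)]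
    (Q : ∀ j, X j →L[ℝ] X (j + 1)) (Lp : ∀ j, X (j + 1) →L[ℝ] X j) (P : ∀ j, X j →L[ℝ] K j) (ι : ∀ j, K j →L[ℝ] X j)
    (hPι : ∀ j h, ι j (P j h) = h - Lp j (Q j h)) {CP : ℕ → ℝ} (hCP : ∀ j, ‖P j‖ ≤ CP j)
    (𝒬 : ∀ j, X 0 →L[ℝ] X j) (h𝒬0 : 𝒬 0 = ContinuousLinearMap.id ℝ (X 0)) (h𝒬 : ∀ j, 𝒬 (j + 1) = (Q j).comp (𝒬 j))
    (ℒ : ∀ j, X j →L[ℝ] X 0) (hℒ0 : ℒ 0 = ContinuousLinearMap.id ℝ (X 0)) (hℒ : ∀ j, ℒ (j + 1) = (ℒ j).comp (Lp j))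
    {Eq₀ : X 0 → X 0} {Eq₀' : X 0 → X 0 →L[ℝ] X 0} (hE0 : Eq₀ 0 = 0)
    {r B M : ℕ → ℝ} (hr0 : ∀ j, 0 ≤ r j) (hM0 : ∀ j, 0 ≤ M j)
    (hE : ∀ x ∈ closedBall (0 : X 0) (r 0), HasFDerivAt Eq₀ (Eq₀' x) x)
    (hB : ∀ x ∈ closedBall (0 : X 0) (r 0), ‖Eq₀' x‖ ≤ B 0)
    (hM : ∀ x ∈ closedBall (0 : X 0) (r 0), ∀ x' ∈ closedBall (0 : X 0) (r 0), ‖Eq₀' x - Eq₀' x'‖ ≤ M 0 * ‖x - x'‖)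
    (T : ∀ j, X j ≃L[ℝ] X (j + 1) × K j) {N c : ℕ → ℝ≥0}
    (hT : ∀ j (𝒮 : X j →L[ℝ] X 0), (𝒬 j).comp 𝒮 = ContinuousLinearMap.id ℝ (X j) →
      (∀ i, i < j → ∀ h, P i (𝒬 i (Eq₀' 0 (𝒮 h))) = 0) → ∀ h, T j h = (Q j h, P j (𝒬 j (Eq₀' 0 (𝒮 h)))))
    (hN : ∀ j (y : X (j + 1) × K j), ‖(T j).symm y‖ ≤ N j * ‖y‖) (hcN : ∀ j, c j < (N j)⁻¹)
    (hc : ∀ j, CP j * M j * r j ≤ (c j : ℝ)) (hr : ∀ j, r (j + 1) < ((N j : ℝ)⁻¹ - c j) * r j)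
    (hBs : ∀ j, ‖Q j‖ * B j * ((N j : ℝ)⁻¹ - c j)⁻¹ ≤ B (j + 1))
    (hMs : ∀ j, ‖Q j‖ * (M j * ((N j : ℝ)⁻¹ - c j)⁻¹ * ((N j : ℝ)⁻¹ - c j)⁻¹ +
      B j * ((((N j : ℝ)⁻¹ - c j)⁻¹) ^ 2 * (CP j * M j) * ((N j : ℝ)⁻¹ - c j)⁻¹)) ≤ M (j + 1))
    -- the one-shot data of the composite blocking at level `k`
    (k : ℕ) (h𝒬ℒ : (𝒬 k).comp (ℒ k) = ContinuousLinearMap.id ℝ (X k))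
    (P₀ : X 0 →L[ℝ] K₀) (ι₀ : K₀ →L[ℝ] X 0) (hPι₀ : ∀ h, ι₀ (P₀ h) = h - ℒ k (𝒬 k h)) (hι₀ : ∀ κ, ι₀ κ = 0 → κ = 0)
    {CP₀ : ℝ} (hCP₀ : ‖P₀‖ ≤ CP₀) (T₀ : X 0 ≃L[ℝ] X k × K₀) (hT₀ : ∀ h, T₀ h = (𝒬 k h, P₀ (Eq₀' 0 h))) {N₀ c₀ : ℝ≥0}
    (hN₀ : ∀ y : X k × K₀, ‖T₀.symm y‖ ≤ N₀ * ‖y‖) (hcN₀ : c₀ < N₀⁻¹) (hc₀ : CP₀ * M 0 * r 0 ≤ (c₀ : ℝ)) :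
    ∃ (σ : ∀ j, X (j + 1) → X j) (Eq : ∀ j, X j → X j) (Eq' : ∀ j, X j → X j →L[ℝ] X j) (𝒮 : ∀ j, X j →L[ℝ] X 0)
      (Φ : ∀ j, X j → X 0) (σ₀ : X k → X 0),
      -- the tower's recursion equations, composite letters and composite lift (SOS, re-exported)
      Eq 0 = Eq₀ ∧ Eq' 0 = Eq₀' ∧ Φ 0 = id ∧ (∀ j, Eq (j + 1) = fun w => Q j (Eq j (σ j w))) ∧
      (∀ j, Eq' (j + 1) = fun w => (Q j).comp ((Eq' j (σ j w)).comp (fderiv ℝ (σ j) w))) ∧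
      (∀ j, Φ (j + 1) = Φ j ∘ σ j) ∧ (∀ j, 𝒮 (j + 1) = (𝒮 j).comp (fderiv ℝ (σ j) 0)) ∧
      (∀ j, Φ j 0 = 0 ∧ (∀ w ∈ closedBall (0 : X j) (r j), Φ j w ∈ closedBall (0 : X 0) (r 0)) ∧
        (∀ w ∈ closedBall (0 : X j) (r j), 𝒬 j (Φ j w) = w) ∧
        LipschitzOnWith (∏ i ∈ Finset.range j, ((N i)⁻¹ - c i)⁻¹) (Φ j) (closedBall (0 : X j) (r j)) ∧
        (∀ w ∈ closedBall (0 : X j) (r j), Eq j w = 0 → Eq₀ (Φ j w) = 0)) ∧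
      (∀ j, ∀ w ∈ closedBall (0 : X j) (r j), Eq₀ (Φ j w) = ℒ j (Eq j w)) ∧
      (∀ j, HasFDerivAt (Φ j) (𝒮 j) 0) ∧
      -- the one-shot branch of the composite blocking at level `k` (SIS (a), Lipschitz, uniqueness — SOS, re-exported)
      σ₀ 0 = 0 ∧
      (∀ v ∈ closedBall (0 : X k) (((N₀ : ℝ)⁻¹ - c₀) * r 0),
        σ₀ v ∈ closedBall (0 : X 0) (r 0) ∧ 𝒬 k (σ₀ v) = v ∧ P₀ (Eq₀ (σ₀ v)) = 0 ∧ Eq₀ (σ₀ v) = ℒ k (𝒬 k (Eq₀ (σ₀ v)))) ∧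
      LipschitzOnWith (N₀⁻¹ - c₀)⁻¹ σ₀ (closedBall (0 : X k) (((N₀ : ℝ)⁻¹ - c₀) * r 0)) ∧
      (∀ x ∈ closedBall (0 : X 0) (r 0), P₀ (Eq₀ x) = 0 → σ₀ (𝒬 k x) = x) ∧
      -- THE IDENTIFICATION (SOS)
      (∀ w ∈ closedBall (0 : X k) (r k), Φ k w = σ₀ w) ∧
      -- (O-b) the one-shot branch's derivative letters on its open chart ball (SIS (b))
      (∀ w ∈ ball (0 : X k) (((N₀ : ℝ)⁻¹ - c₀) * r 0), DifferentiableAt ℝ σ₀ w ∧ ‖fderiv ℝ σ₀ w‖ ≤ ((N₀ : ℝ)⁻¹ - c₀)⁻¹ ∧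
        (𝒬 k).comp (fderiv ℝ σ₀ w) = ContinuousLinearMap.id ℝ (X k) ∧ ∀ y, P₀ (Eq₀' (σ₀ w) (fderiv ℝ σ₀ w y)) = 0) ∧
      -- (ID′) THE COMPOSITE RESPONSE IS THE ONE-SHOT RESPONSE on `ball 0 r_k ∩ ball 0 ρ₀ₖ` (weights play no part)
      (∀ w ∈ ball (0 : X k) (r k) ∩ ball (0 : X k) (((N₀ : ℝ)⁻¹ - c₀) * r 0),
        DifferentiableAt ℝ (Φ k) w ∧ fderiv ℝ (Φ k) w = fderiv ℝ σ₀ w) ∧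
      -- THE SECOND CURRENCY AT THE COMPOSITE LEVEL — for EVERY choice, AFTER the tower and the one-shot branch, of seminorms `p₀` on
      -- `X 0`, `p_k` on `X k`, `q₀` on `K₀`, `0 ≤ N^w_{0k}, M^w_0, C^w_{P₀ₖ}`, the one-shot chart's letter, the level-`0` modulus, `P₀ₖ`'s
      -- letter, `C^w_{P₀ₖ} M^w_0 r_0 ≤ c^w_{0k}` and `N^w_{0k} c^w_{0k} < 1`: (OW1) the composite covariance column, (OW2) the one-shot response
      -- letter, (OW3) its two-point modulus, and (OW4) the composite response letter with ONE bootstrap constant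
      (∀ (p₀ : Seminorm ℝ (X 0)) (pk : Seminorm ℝ (X k)) (q₀ : Seminorm ℝ K₀) (Nw₀ cw₀ Mw₀ CPw₀ : ℝ),
        0 ≤ Nw₀ → 0 ≤ Mw₀ → 0 ≤ CPw₀ →
        (∀ y₁ y₂, p₀ (T₀.symm (y₁, y₂)) ≤ Nw₀ * (pk y₁ + q₀ y₂)) →
        (∀ x ∈ closedBall (0 : X 0) (r 0), ∀ x' ∈ closedBall (0 : X 0) (r 0), ∀ u,
          p₀ ((Eq₀' x - Eq₀' x') u) ≤ Mw₀ * ‖x - x'‖ * p₀ u) →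
        (∀ h, q₀ (P₀ h) ≤ CPw₀ * p₀ h) → CPw₀ * Mw₀ * r 0 ≤ cw₀ → Nw₀ * cw₀ < 1 →
        -- (OW1) THE COMPOSITE COVARIANCE COLUMN at every one-shot background
        (∀ w ∈ closedBall (0 : X k) (((N₀ : ℝ)⁻¹ - c₀) * r 0), ∀ u, 𝒬 k u = 0 →
          p₀ u ≤ Nw₀ / (1 - Nw₀ * cw₀) * q₀ (P₀ (Eq₀' (σ₀ w) u))) ∧
        -- (OW2) the one-shot response letter and (OW3) its two-point modulus
        (∀ w ∈ ball (0 : X k) (((N₀ : ℝ)⁻¹ - c₀) * r 0), ∀ y, p₀ (fderiv ℝ σ₀ w y) ≤ Nw₀ / (1 - Nw₀ * cw₀) * pk y) ∧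
        (∀ w ∈ ball (0 : X k) (((N₀ : ℝ)⁻¹ - c₀) * r 0), ∀ w' ∈ ball (0 : X k) (((N₀ : ℝ)⁻¹ - c₀) * r 0), ∀ y,
          p₀ ((fderiv ℝ σ₀ w - fderiv ℝ σ₀ w') y) ≤
            Nw₀ / (1 - Nw₀ * cw₀) * CPw₀ * Mw₀ * ((N₀ : ℝ)⁻¹ - c₀)⁻¹ * (Nw₀ / (1 - Nw₀ * cw₀)) * ‖w - w'‖ * pk y) ∧
        -- (OW4) THE COMPOSITE RESPONSE LETTER WITH ONE BOOTSTRAP CONSTANT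
        (∀ w ∈ ball (0 : X k) (r k) ∩ ball (0 : X k) (((N₀ : ℝ)⁻¹ - c₀) * r 0), ∀ y,
          p₀ (fderiv ℝ (Φ k) w y) ≤ Nw₀ / (1 - Nw₀ * cw₀) * pk y)) := by
  obtain ⟨σ, Eq, Eq', 𝒮, Φ, hEq0, hEq'0, -, hΦ0, hEs, hE's, h𝒮s, hΦs, hC, hcl, hD⟩ :=
    SupEquationTowerLetters.tower_eq_compositeLetters Q Lp P ι hPι hCP 𝒬 h𝒬0 h𝒬 ℒ hℒ0 hℒ hE0 hr0 hM0 hE hB hM T hT hN hcN hc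
      hr hBs hMs
  -- the one-shot step: SIS at the composite level, smallness = modulus × radius at level `0`
  have hck : ∀ x ∈ closedBall (0 : X 0) (r 0), ‖P₀.comp (Eq₀' x - Eq₀' 0)‖ ≤ c₀ := fun x hx =>
    (SupEquationTowerStep.norm_comp_sub_le_of_modulus_closedBall P₀ hCP₀ (hM0 0) (hr0 0) hM hx).trans hc₀
  obtain ⟨σ₀, h00, h0a, h0lip, h0uniq, h0b, -, -, -, -, -⟩ :=
    SupInductiveStep.inductiveStep_eq (𝒬 k) (ℒ k) P₀ ι₀ hPι₀ hCP₀ hE0 (hr0 0) hE hB (hM0 0) hM (Eq₀' 0) T₀ hT₀ hN₀ hcN₀ hck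
  -- the identification (SOS's argument, inlined: criticality for the composite fibre from the composite lift, then SIS's uniqueness)
  have hid : ∀ w ∈ closedBall (0 : X k) (r k), Φ k w = σ₀ w := by
    intro w hw
    obtain ⟨-, hmem, hsec, -, -⟩ := hC k
    have hcrit : P₀ (Eq₀ (Φ k w)) = 0 := by
      apply hι₀
      have e : 𝒬 k (ℒ k (Eq k w)) = Eq k w := by
        simpa using congrArg (fun L : X k →L[ℝ] X k => L (Eq k w)) h𝒬ℒ
      rw [hPι₀, hcl k w hw, e, sub_self]
    have h := h0uniq (Φ k w) (hmem w hw) hcrit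
    rw [hsec w hw] at h
    exact h.symm
  -- weight-free bookkeeping on the one-shot ball
  have hK1 : (0 : ℝ) ≤ ((N₀ : ℝ)⁻¹ - c₀)⁻¹ := by
    have h := NNReal.coe_lt_coe.2 hcN₀
    rw [NNReal.coe_inv] at h
    exact inv_nonneg.2 (sub_pos.2 h).le
  have hcoe : (((N₀⁻¹ - c₀)⁻¹ : ℝ≥0) : ℝ) = ((N₀ : ℝ)⁻¹ - c₀)⁻¹ := by
    rw [NNReal.coe_inv, NNReal.coe_sub hcN₀.le, NNReal.coe_inv]
  have hσr : ∀ w ∈ ball (0 : X k) (((N₀ : ℝ)⁻¹ - c₀) * r 0), σ₀ w ∈ closedBall (0 : X 0) (r 0) := fun w hw =>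
    (h0a w (ball_subset_closedBall hw)).1
  have hσLip : ∀ w ∈ ball (0 : X k) (((N₀ : ℝ)⁻¹ - c₀) * r 0), ∀ w' ∈ ball (0 : X k) (((N₀ : ℝ)⁻¹ - c₀) * r 0),
      ‖σ₀ w - σ₀ w'‖ ≤ ((N₀ : ℝ)⁻¹ - c₀)⁻¹ * ‖w - w'‖ := fun w hw w' hw' => by
    have h := h0lip.dist_le_mul w (ball_subset_closedBall hw) w' (ball_subset_closedBall hw')
    rw [dist_eq_norm, dist_eq_norm, hcoe] at h
    exact h
  -- (ID′) weight-free: the derivatives agree on `ball 0 r_k`, differentiability transfers on the one-shot open ball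
  have hID : ∀ w ∈ ball (0 : X k) (r k) ∩ ball (0 : X k) (((N₀ : ℝ)⁻¹ - c₀) * r 0),
      DifferentiableAt ℝ (Φ k) w ∧ fderiv ℝ (Φ k) w = fderiv ℝ σ₀ w := fun w hw => by
    obtain ⟨hwr, hwρ⟩ := hw
    obtain ⟨he, hdiff⟩ := fderiv_eq_of_eqOn_closedBall hid hwr
    obtain ⟨hdσ, -, -, -⟩ := h0b w hwρ
    exact ⟨hdiff hdσ, he⟩
  refine ⟨σ, Eq, Eq', 𝒮, Φ, σ₀, hEq0, hEq'0, hΦ0, hEs, hE's, hΦs, h𝒮s, hC, hcl, hD, h00, h0a, h0lip, h0uniq, hid, h0b, hID, ?_⟩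
  -- the second currency, AFTER the tower and the one-shot branch
  intro p₀ pk q₀ Nw₀ cw₀ Mw₀ CPw₀ hNw₀ hMw₀ hCPw₀ hTw₀ hMw hCPw hcw₀ hsmall₀
  have hcw : ∀ x ∈ closedBall (0 : X 0) (r 0), ∀ u, q₀ (P₀ ((Eq₀' 0 - Eq₀' x) u)) ≤ cw₀ * p₀ u := fun x hx u => by
    have hxr : ‖x‖ ≤ r 0 := by rwa [mem_closedBall, dist_zero_right] at hx
    refine (seminorm_defect_le_of_modulus_norm P₀ p₀ q₀ hCPw₀ hCPw hMw hx u).trans ?_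
    refine mul_le_mul_of_nonneg_right ?_ (apply_nonneg _ _)
    exact (mul_le_mul_of_nonneg_left hxr (mul_nonneg hCPw₀ hMw₀)).trans hcw₀
  have hOW2 : ∀ w ∈ ball (0 : X k) (((N₀ : ℝ)⁻¹ - c₀) * r 0), ∀ y,
      p₀ (fderiv ℝ σ₀ w y) ≤ Nw₀ / (1 - Nw₀ * cw₀) * pk y := fun w hw y => by
    obtain ⟨-, -, hQD, hPD⟩ := h0b w hw
    exact SupResponseSecondCurrency.seminorm_section_le (𝒬 k) P₀ (Eq₀' 0) (Eq₀' (σ₀ w)) T₀ hT₀ p₀ pk q₀ hNw₀ hTw₀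
      (hcw _ (hσr w hw)) hsmall₀ hQD hPD y
  refine ⟨fun w hw u hQu => ?_, hOW2, fun w hw w' hw' y => ?_, fun w hw y => ?_⟩
  · -- (OW1) the composite covariance column
    exact SupResponseSecondCurrency.seminorm_fibre_le (𝒬 k) P₀ (Eq₀' 0) (Eq₀' (σ₀ w)) T₀ hT₀ p₀ pk q₀ hNw₀ hTw₀
      (hcw _ (h0a w hw).1) hsmall₀ hQu
  · -- (OW3) the two-point modulus
    obtain ⟨-, -, hQD, hPD⟩ := h0b w hw
    obtain ⟨-, -, hQD', hPD'⟩ := h0b w' hw'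
    have hδ : 0 ≤ Mw₀ * (((N₀ : ℝ)⁻¹ - c₀)⁻¹ * ‖w - w'‖) := mul_nonneg hMw₀ (mul_nonneg hK1 (norm_nonneg _))
    have hX : ∀ u, p₀ ((Eq₀' (σ₀ w') - Eq₀' (σ₀ w)) u) ≤ Mw₀ * (((N₀ : ℝ)⁻¹ - c₀)⁻¹ * ‖w - w'‖) * p₀ u := fun u => by
      refine (hMw _ (hσr w' hw') _ (hσr w hw) u).trans (mul_le_mul_of_nonneg_right ?_ (apply_nonneg _ _))
      refine mul_le_mul_of_nonneg_left ?_ hMw₀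
      rw [norm_sub_rev]; exact hσLip w hw w' hw'
    refine (SupResponseSecondCurrency.seminorm_section_sub_le_of_modulus (𝒬 k) P₀ (Eq₀' 0) (Eq₀' (σ₀ w)) (Eq₀' (σ₀ w')) T₀ hT₀
      p₀ pk q₀ hNw₀ hTw₀ (hcw _ (hσr w hw)) hsmall₀ hQD hQD' hPD hPD' hCPw₀ hδ hCPw hX (hOW2 w' hw') y).trans_eq ?_
    ring
  · -- (OW4) the composite response letter with ONE bootstrap constant
    rw [(hID w hw).2]
    exact hOW2 w hw.2 y

/-! ## §3. Toy -/

/-- Toy: ONE bootstrap constant versus the product — with `N^w = 2`, `c^w = 1∕4` the one-shot letter is `4` at EVERY level, while a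
two-level product of the same per-level letters is `16` (`…SupEquationTowerWeighted`'s toy). -/
example : (2 : ℝ) / (1 - 2 * (1 / 4)) = 4 ∧ (2 : ℝ) / (1 - 2 * (1 / 4)) * (2 / (1 - 2 * (1 / 4))) = 16 := by norm_num

end Summit.QuantumFields.BalabanUV.T4Continuum.NE7b.SupEquationTowerOneShotWeighted

end
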